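import Summits.Parity.GeneralizedHardyLittlewood.Theorems.BeyondDiagonalBeatsQuarter.OffDiagCoreSplitAlgebra
import Summits.Parity.GeneralizedHardyLittlewood.Theorems.BeyondDiagonalBeatsQuarter.OffDiagCoreRanges
import Summits.Parity.GeneralizedHardyLittlewood.Theorems.BeyondDiagonalBeatsQuarter.OffDiagHeartCoreSplit
import HarnessLib

/-!
# Route `PrimeLevelFamEdge`, crux K_B (stmt-Parity-20343), line `diagonal_kernel_split` rev 4, plan Ω —
# L7d part 2, node D1b `OffDiagCoreLevels`: **the switched pieces of the block core with the LEVEL SUM INNERMOST,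
# against one switched pair `(h₁, s)` — and `coreL` as a finite-nest sum of `levelLargePart`s of explicit level weights**

`OffDiagCoreRanges.sum_levels_coreNest_eq_enlarged` (prover-7) moves the level sum `Σ_{q∈G}` inside the q-free cell nest
`(r, l, m, d₁, d₂, i)` at the block top `Q = 2N`. Inside a switched cell (`switchedCellW W`, `OffDiagCoreSplitAlgebra`) the
level still sits OUTSIDE the dual-modulus range `|h₁| ≤ Hf q …` and the `s`-series. This file finishes the exchange:

* `sum_mul_switchedCellW_eq` — for one cell, levels `G` (all `≥ 2`), a scalar level factor `c q`, a bounded weight `W` and a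
  common height `H′ ≥ Hf q …` on `G`: `Σ_{q∈G} c q·switchedCellW W Hf q … = 𝟙[(l/d₁,r+1)=1]·Σ_{|h₁|≤H′} Σ'_s Σ_{q∈G}
  𝟙[|h₁| ≤ Hf q …]·𝟙[h₁ unit mod q(r+1)]·𝟙[adm(s,h₁)]·c q·W·Φ̂_q` (finite exchanges + `Summable.tsum_finsetSum`, the
  summability from `summable_fourier2_boxWeight_intShift`, prover-8);
* **`coreWithW_eq_levels`** — `coreWithW W G Hf Δ′ = −re(Σ_{cell nest at Q} 𝟙[cop]·Σ_{|h₁| ≤ H*(cell)} Σ'_s Σ_{q∈G} F_W(cell,h₁,s; q))`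
  with the explicit LEVEL WEIGHT
  `F_W(…; q) = 𝟙[cell ∈ ranges q ∧ |h₁| ≤ Hf q … ∧ h₁ unit mod q(r+1) ∧ adm]·2q̂(2π/q)·c_l(q)c_m(q)·W(q,…)·Φ̂_q(h₁/(q(r+1)), s/h₁+ab/(h₁q(r+1)))`
  — ALL `q`-dependence inside `F_W`;
* **`coreL_eq_levels_levelLargePart`** — for `coreL R` (kernel `levelLargePart R {q} 1 n a`, `n = switchMod`, `a = switchClass`,
  both level-free): the innermost level sum IS `levelLargePart R G (F₁(cell,h₁,s)) n a` of the kernel-free level weight `F₁`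
  (`sum_levelLargePart_singleton_mul`) — the object prover-7's `norm_sum_mul_levelLargePart_le_of_multiplicity_zmod` bounds
  once `F₁` is separated (prover-8 `levelFactor_separation_box`) — node D5.

Finite algebra and `tsum` bookkeeping over landed identities; theorems only; standard axioms. Helper toward
`stub_offDiagBelowSlack_io`; closes nothing.
«The programme SEARCHES and TYPES; no claim about Landau–Siegel zeros, Theorems 1–2 of arXiv:2211.02515 or
a repaired Margin232 until a kernel theorem says so.»
-/

noncomputable section

open Finset Polynomial
open scoped Real FourierTransform

namespace Summit.Parity.GeneralizedHardyLittlewood.Theorems.BeyondDiagonalBeatsQuarter.OffDiag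

open Literature.NumberTheory.LFunctions Literature.NumberTheory.LFunctions.KMV2000
open Literature.NumberTheory.Sieve.FriedlanderIwaniecPrimes (fourier2)
open PeterssonSplit (nearBoxes)

/-! ### §1. One cell: the level sum inside the dual-modulus range and the `s`-series -/

/-- Congruence helper `S = S′ ⇒ −re S = −re S′` (avoids `congr` on large nests). [folklore] -/
theorem neg_re_congr {S S' : ℂ} (h : S = S') : -(S.re) = -(S'.re) := by rw [h]

open Classical in
/-- **The level-innermost summand of a switched cell**: for levels `q`, a scalar level factor `c q`, weight `W`, cell
`(r,l,m,d₁,d₂,i)` and switched pair `(h₁,s)`: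
`𝟙[|h₁| ≤ Hf q …]·𝟙[h₁ unit mod q(r+1)]·𝟙[g ∣ ab ∧ class unit]·c q·W(q,…,h₁,s)·Φ̂_{q,…}(h₁/(q(r+1)), s/h₁ + ab/(h₁q(r+1)))`.
[cite: KowalskiMichelVanderKam2000, §6 p. 19, (21)–(23) p. 12 — derivation] -/
def levelSummand (c : ℕ → ℂ) (W : ℕ → ℕ → ℕ → ℕ → ℕ → ℕ → ℕ × ℕ → ℤ → ℤ → ℂ)
    (Hf : ℕ → ℕ → ℕ → ℕ → ℕ → ℕ → ℕ × ℕ → ℕ) (r l m d₁ d₂ : ℕ) (i : ℕ × ℕ) (h₁ s : ℤ) (q : ℕ) : ℂ :=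
  if |h₁| ≤ (Hf q d₁ d₂ (l / d₁) (m / d₂) (r + 1) i : ℤ) then
    if IsUnit ((h₁ : ℤ) : ZMod (q * (r + 1))) then
      if ((switchGcd (r + 1) s h₁ : ℤ) ∣ ((l / d₁ : ℕ) : ℤ) * (m / d₂ : ℕ) ∧
          IsUnit (switchClass (r + 1) (((l / d₁ : ℕ) : ℤ) * (m / d₂ : ℕ)) s h₁)) then
        c q * (W q r l m d₁ d₂ i h₁ s *
          fourier2 (boxWeight q d₁ d₂ (l / d₁) (m / d₂) (r + 1) i) (h₁ / (q * (r + 1) : ℕ))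
            ((s : ℝ) / h₁ + (((l / d₁ : ℕ) : ℤ) * (m / d₂ : ℕ) : ℝ) / ((h₁ : ℝ) * (q * (r + 1) : ℕ))))
      else 0
    else 0
  else 0

/-- The level summand is summable in `s` for every level `q ≥ 2` and bounded weight (it vanishes unless `h₁` is a unit,
and then `h₁ ≠ 0` and the box transform is summable along the shifted lattice). [folklore] -/
theorem summable_levelSummand (c : ℕ → ℂ) {W : ℕ → ℕ → ℕ → ℕ → ℕ → ℕ → ℕ × ℕ → ℤ → ℤ → ℂ} {B : ℝ}
    (hW : ∀ q r l m d₁ d₂ i h₁ s, ‖W q r l m d₁ d₂ i h₁ s‖ ≤ B)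
    (Hf : ℕ → ℕ → ℕ → ℕ → ℕ → ℕ → ℕ × ℕ → ℕ) {q : ℕ} (hq : 2 ≤ q) (r l m d₁ d₂ : ℕ) (i : ℕ × ℕ) (h₁ : ℤ) :
    Summable (fun s : ℤ ↦ levelSummand c W Hf r l m d₁ d₂ i h₁ s q) := by
  classical
  unfold levelSummand
  by_cases hH : |h₁| ≤ (Hf q d₁ d₂ (l / d₁) (m / d₂) (r + 1) i : ℤ)
  swap
  · simp only [if_neg hH]; exact summable_zero
  simp only [if_pos hH]
  by_cases hu : IsUnit ((h₁ : ℤ) : ZMod (q * (r + 1)))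
  swap
  · simp only [if_neg hu]; exact summable_zero
  simp only [if_pos hu]
  have hC : 2 ≤ q * (r + 1) := le_trans hq (Nat.le_mul_of_pos_right q (Nat.succ_pos r))
  haveI : NeZero (q * (r + 1)) := ⟨by omega⟩
  haveI : NeZero q := ⟨by omega⟩
  have hh₁ : h₁ ≠ 0 := intCast_ne_zero_of_isUnit hC hu
  have hΦ := summable_fourier2_boxWeight_intShift q d₁ d₂ (l / d₁) (m / d₂) (r + 1) i
    ((h₁ : ℝ) / (q * (r + 1) : ℕ)) ((((l / d₁ : ℕ) : ℤ) * (m / d₂ : ℕ) : ℝ) / ((h₁ : ℝ) * (q * (r + 1) : ℕ))) hh₁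
  have hB : 0 ≤ B := (norm_nonneg _).trans (hW 0 0 0 0 0 0 (0, 0) 0 0)
  refine Summable.of_norm_bounded (hΦ.norm.mul_left (‖c q‖ * B)) fun s ↦ ?_
  split_ifs
  · rw [norm_mul, norm_mul, mul_assoc]
    exact mul_le_mul_of_nonneg_left (mul_le_mul_of_nonneg_right (hW q r l m d₁ d₂ i h₁ s) (norm_nonneg _))
      (norm_nonneg _)
  · rw [norm_zero]; positivity

open Classical in
/-- **One cell, level sum inside**: for levels `G` (all `≥ 2`), a scalar level factor `c`, a bounded weight `W`, a common
height `H′` with `Hf q … ≤ H′` on `G`: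
`Σ_{q∈G} c q·switchedCellW W Hf q r l m d₁ d₂ i = 𝟙[(l/d₁, r+1) = 1]·Σ_{|h₁| ≤ H′} Σ'_s Σ_{q∈G} levelSummand c W Hf … h₁ s q`.
[cite: KowalskiMichelVanderKam2000, §6 p. 19, (21)–(23) p. 12 — derivation] -/
theorem sum_mul_switchedCellW_eq (c : ℕ → ℂ) {W : ℕ → ℕ → ℕ → ℕ → ℕ → ℕ → ℕ × ℕ → ℤ → ℤ → ℂ} {B : ℝ}
    (hW : ∀ q r l m d₁ d₂ i h₁ s, ‖W q r l m d₁ d₂ i h₁ s‖ ≤ B)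
    (Hf : ℕ → ℕ → ℕ → ℕ → ℕ → ℕ → ℕ × ℕ → ℕ) (G : Finset ℕ) (hG : ∀ q ∈ G, 2 ≤ q)
    (r l m d₁ d₂ : ℕ) (i : ℕ × ℕ) {H' : ℕ} (hH : ∀ q ∈ G, Hf q d₁ d₂ (l / d₁) (m / d₂) (r + 1) i ≤ H') :
    ∑ q ∈ G, c q * switchedCellW W Hf q r l m d₁ d₂ i =
      if Nat.Coprime (l / d₁) (r + 1) then
        ∑ h₁ ∈ Icc (-(H' : ℤ)) H', ∑' s : ℤ, ∑ q ∈ G, levelSummand c W Hf r l m d₁ d₂ i h₁ s q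
      else 0 := by
  by_cases hcop : Nat.Coprime (l / d₁) (r + 1)
  swap
  · simp only [switchedCellW, if_neg hcop, mul_zero, Finset.sum_const_zero]
  simp only [switchedCellW, if_pos hcop]
  -- enlarge each level's modulus range to `[−H′, H′]` and exchange with the level sum
  have hstep : ∀ q ∈ G, c q * ∑ h₁ ∈ Icc (-(Hf q d₁ d₂ (l / d₁) (m / d₂) (r + 1) i : ℤ))
        (Hf q d₁ d₂ (l / d₁) (m / d₂) (r + 1) i),
        (if IsUnit ((h₁ : ℤ) : ZMod (q * (r + 1))) then
          ∑' s : ℤ,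
            (if ((switchGcd (r + 1) s h₁ : ℤ) ∣ ((l / d₁ : ℕ) : ℤ) * (m / d₂ : ℕ) ∧
                IsUnit (switchClass (r + 1) (((l / d₁ : ℕ) : ℤ) * (m / d₂ : ℕ)) s h₁)) then
              W q r l m d₁ d₂ i h₁ s *
                fourier2 (boxWeight q d₁ d₂ (l / d₁) (m / d₂) (r + 1) i) (h₁ / (q * (r + 1) : ℕ))
                  ((s : ℝ) / h₁ + (((l / d₁ : ℕ) : ℤ) * (m / d₂ : ℕ) : ℝ) / ((h₁ : ℝ) * (q * (r + 1) : ℕ)))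
            else 0)
        else 0) =
      ∑ h₁ ∈ Icc (-(H' : ℤ)) H', ∑' s : ℤ, levelSummand c W Hf r l m d₁ d₂ i h₁ s q := by
    intro q hq
    rw [sum_Icc_eq_sum_Icc_ite_of_le (hH q hq), Finset.mul_sum]
    refine Finset.sum_congr rfl fun h₁ _ ↦ ?_
    unfold levelSummand
    by_cases hh : |h₁| ≤ (Hf q d₁ d₂ (l / d₁) (m / d₂) (r + 1) i : ℤ)
    swap
    · simp only [if_neg hh, mul_zero, tsum_zero]
    simp only [if_pos hh]
    by_cases hu : IsUnit ((h₁ : ℤ) : ZMod (q * (r + 1)))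
    swap
    · simp only [if_neg hu, mul_zero, tsum_zero]
    simp only [if_pos hu]
    rw [← tsum_mul_left]
    refine tsum_congr fun s ↦ ?_
    split_ifs
    · rfl
    · exact mul_zero _
  rw [Finset.sum_congr rfl hstep, Finset.sum_comm]
  refine Finset.sum_congr rfl fun h₁ _ ↦ ?_
  exact (Summable.tsum_finsetSum fun q hq ↦ summable_levelSummand c hW Hf (hG q hq) r l m d₁ d₂ i h₁).symm

/-! ### §2. The block piece with the level sum innermost -/

/-- The block top: a common bound for the truncation heights of one cell over the levels of `G` (any bound works; we take
the `Finset.sup`). [folklore] -/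
theorem hf_le_sup (G : Finset ℕ) (Hf : ℕ → ℕ → ℕ → ℕ → ℕ → ℕ → ℕ × ℕ → ℕ) (r l m d₁ d₂ : ℕ) (i : ℕ × ℕ)
    {q : ℕ} (hq : q ∈ G) :
    Hf q d₁ d₂ (l / d₁) (m / d₂) (r + 1) i ≤ G.sup (fun q ↦ Hf q d₁ d₂ (l / d₁) (m / d₂) (r + 1) i) :=
  Finset.le_sup (f := fun q ↦ Hf q d₁ d₂ (l / d₁) (m / d₂) (r + 1) i) hq

open Classical in
/-- **The block piece with a general weight, level sum innermost.** For levels `G` with `2 ≤ q ≤ Q` on `G`, `Δ′ ≥ 0`, a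
bounded weight `W` and any `Hf`:
`coreWithW W G Hf Δ′ = −re(Σ_{r<Q⁷} Σ_{l,m≤⌊q̂(Q)^{Δ′}⌋} Σ_{d₁∣l,d₂∣m} Σ_{i∈nearBoxes Q d (log Q)⁴} 𝟙[(l/d₁,r+1)=1]·
   Σ_{|h₁| ≤ H*(cell)} Σ'_s Σ_{q∈G} levelSummand c_{cell} W Hf cell h₁ s q)`,
`c_{cell} q = 𝟙[cell ∈ ranges q]·2q̂(2π/q)·c_l(q)c_m(q)`, `H*(cell) = sup_{q∈G} Hf q …`.
[cite: KowalskiMichelVanderKam2000, §6 p. 19, (21)–(23) p. 12 — derivation] -/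
theorem coreWithW_eq_levels {W : ℕ → ℕ → ℕ → ℕ → ℕ → ℕ → ℕ × ℕ → ℤ → ℤ → ℂ} {B : ℝ}
    (hW : ∀ q r l m d₁ d₂ i h₁ s, ‖W q r l m d₁ d₂ i h₁ s‖ ≤ B) (G : Finset ℕ) {Q : ℕ}
    (hG : ∀ q ∈ G, 2 ≤ q ∧ q ≤ Q) (Hf : ℕ → ℕ → ℕ → ℕ → ℕ → ℕ → ℕ × ℕ → ℕ) {Δ' : ℝ} (hΔ : 0 ≤ Δ') :
    coreWithW W G Hf Δ' =
      -((∑ r ∈ Finset.range (Q ^ 7), ∑ l ∈ Finset.Icc 1 ⌊qhat Q ^ Δ'⌋₊, ∑ m ∈ Finset.Icc 1 ⌊qhat Q ^ Δ'⌋₊,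
          ∑ d₁ ∈ l.divisors, ∑ d₂ ∈ m.divisors, ∑ i ∈ nearBoxes Q d₁ d₂ (Real.log Q ^ 4),
            if Nat.Coprime (l / d₁) (r + 1) then
              ∑ h₁ ∈ Icc (-((G.sup (fun q ↦ Hf q d₁ d₂ (l / d₁) (m / d₂) (r + 1) i) : ℕ) : ℤ))
                  ((G.sup (fun q ↦ Hf q d₁ d₂ (l / d₁) (m / d₂) (r + 1) i) : ℕ) : ℤ),
                ∑' s : ℤ, ∑ q ∈ G,
                  levelSummand (fun q ↦ if r < q ^ 7 ∧ l ≤ ⌊qhat q ^ Δ'⌋₊ ∧ m ≤ ⌊qhat q ^ Δ'⌋₊ ∧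
                        i ∈ nearBoxes q d₁ d₂ (Real.log q ^ 4) then
                      2 * (qhat q : ℂ) * (2 * π / q) *
                        (((mollifierCoeff (X ^ 2) (qhat q ^ Δ') l * mollifierCoeff (X ^ 2) (qhat q ^ Δ') m : ℝ) : ℂ))
                    else 0) W Hf r l m d₁ d₂ i h₁ s q
            else 0).re) := by
  have hG' : ∀ q ∈ G, 1 ≤ q ∧ q ≤ Q := fun q hq ↦ ⟨by have := (hG q hq).1; omega, (hG q hq).2⟩
  -- prover-7's nest exchange, instantiated on the weight cells
  have hnest : coreWithW W G Hf Δ' =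
      ∑ q ∈ G, -((2 * (qhat q : ℂ) * (2 * π / q) *
        ∑ r ∈ Finset.range (q ^ 7), ∑ l ∈ Finset.Icc 1 ⌊qhat q ^ Δ'⌋₊, ∑ m ∈ Finset.Icc 1 ⌊qhat q ^ Δ'⌋₊,
          (((mollifierCoeff (X ^ 2) (qhat q ^ Δ') l * mollifierCoeff (X ^ 2) (qhat q ^ Δ') m : ℝ) : ℂ)) *
            ∑ d₁ ∈ l.divisors, ∑ d₂ ∈ m.divisors, ∑ i ∈ nearBoxes q d₁ d₂ (Real.log q ^ 4),
              switchedCellW W Hf q r l m d₁ d₂ i).re) := by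
    unfold coreWithW
    refine Finset.sum_congr rfl fun q hq ↦ ?_
    have hq0 : q ≠ 0 := by have := (hG q hq).1; omega
    rw [dif_neg hq0]
    rfl
  rw [hnest, sum_levels_coreNest_eq_enlarged G hG' hΔ (fun q ↦ 2 * (qhat q : ℂ) * (2 * π / q))
    (fun q l m ↦ (((mollifierCoeff (X ^ 2) (qhat q ^ Δ') l * mollifierCoeff (X ^ 2) (qhat q ^ Δ') m : ℝ) : ℂ)))
    (fun q ↦ switchedCellW W Hf q)]
  refine neg_re_congr ?_
  refine Finset.sum_congr rfl fun r _ ↦ Finset.sum_congr rfl fun l _ ↦ Finset.sum_congr rfl fun m _ ↦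
    Finset.sum_congr rfl fun d₁ _ ↦ Finset.sum_congr rfl fun d₂ _ ↦ Finset.sum_congr rfl fun i _ ↦ ?_
  -- `𝟙[ranges]·P·(C·cell) = c q · cell`, then §1
  have hre : ∀ q ∈ G, (if r < q ^ 7 ∧ l ≤ ⌊qhat q ^ Δ'⌋₊ ∧ m ≤ ⌊qhat q ^ Δ'⌋₊ ∧ i ∈ nearBoxes q d₁ d₂ (Real.log q ^ 4)
        then 2 * (qhat q : ℂ) * (2 * π / q) *
          ((((mollifierCoeff (X ^ 2) (qhat q ^ Δ') l * mollifierCoeff (X ^ 2) (qhat q ^ Δ') m : ℝ) : ℂ)) *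
            switchedCellW W Hf q r l m d₁ d₂ i) else 0) =
      (if r < q ^ 7 ∧ l ≤ ⌊qhat q ^ Δ'⌋₊ ∧ m ≤ ⌊qhat q ^ Δ'⌋₊ ∧ i ∈ nearBoxes q d₁ d₂ (Real.log q ^ 4) then
          2 * (qhat q : ℂ) * (2 * π / q) *
            (((mollifierCoeff (X ^ 2) (qhat q ^ Δ') l * mollifierCoeff (X ^ 2) (qhat q ^ Δ') m : ℝ) : ℂ))
        else 0) * switchedCellW W Hf q r l m d₁ d₂ i := by
    intro q _
    split_ifs
    · ring
    · rw [zero_mul]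
  rw [Finset.sum_congr rfl hre]
  exact sum_mul_switchedCellW_eq _ hW Hf G (fun q hq ↦ (hG q hq).1) r l m d₁ d₂ i
    (fun q hq ↦ hf_le_sup G Hf r l m d₁ d₂ i hq)

/-! ### §3. `coreL`: the innermost level sum is a `levelLargePart` of an explicit level weight -/

open Classical in
/-- **The kernel-free level weight** of the block core at cell `(r,l,m,d₁,d₂,i)` and switched pair `(h₁,s)`, for a
level-free cell/pair selector `D` (`= 1` for the whole piece; `𝟙_D` for a domain cut):
`F(q) = 𝟙[cell ∈ ranges q ∧ |h₁| ≤ Hf q … ∧ h₁ unit mod q(r+1) ∧ adm]·D(cell,h₁,s)·2q̂(2π/q)·c_l(q)c_m(q)·Φ̂_q(h₁/(q(r+1)), s/h₁ + ab/(h₁q(r+1)))`.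
[cite: KowalskiMichelVanderKam2000, §6 p. 19, (21)–(23) p. 12 — derivation] -/
def coreLevelWeight (D : ℕ → ℕ → ℕ → ℕ → ℕ → ℕ × ℕ → ℤ → ℤ → ℂ)
    (Hf : ℕ → ℕ → ℕ → ℕ → ℕ → ℕ → ℕ × ℕ → ℕ) (Δ' : ℝ) (r l m d₁ d₂ : ℕ) (i : ℕ × ℕ) (h₁ s : ℤ) (q : ℕ) : ℂ :=
  levelSummand (fun q ↦ if r < q ^ 7 ∧ l ≤ ⌊qhat q ^ Δ'⌋₊ ∧ m ≤ ⌊qhat q ^ Δ'⌋₊ ∧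
        i ∈ nearBoxes q d₁ d₂ (Real.log q ^ 4) then
      2 * (qhat q : ℂ) * (2 * π / q) *
        (((mollifierCoeff (X ^ 2) (qhat q ^ Δ') l * mollifierCoeff (X ^ 2) (qhat q ^ Δ') m : ℝ) : ℂ))
    else 0) (fun _ r l m d₁ d₂ i h₁ s ↦ D r l m d₁ d₂ i h₁ s) Hf r l m d₁ d₂ i h₁ s q

open Classical in
/-- For a weight `W = D(cell,h₁,s)·K (r+1) ab s h₁ q` (level-free selector times level kernel) the level summand factors as
`K … q · coreLevelWeight D … q`. [folklore] -/
theorem levelSummand_selector_mul_kernel (D : ℕ → ℕ → ℕ → ℕ → ℕ → ℕ × ℕ → ℤ → ℤ → ℂ)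
    (K : ℕ → ℤ → ℤ → ℤ → ℕ → ℂ) (Hf : ℕ → ℕ → ℕ → ℕ → ℕ → ℕ → ℕ × ℕ → ℕ) (Δ' : ℝ)
    (r l m d₁ d₂ : ℕ) (i : ℕ × ℕ) (h₁ s : ℤ) (q : ℕ) :
    levelSummand (fun q ↦ if r < q ^ 7 ∧ l ≤ ⌊qhat q ^ Δ'⌋₊ ∧ m ≤ ⌊qhat q ^ Δ'⌋₊ ∧
          i ∈ nearBoxes q d₁ d₂ (Real.log q ^ 4) then
        2 * (qhat q : ℂ) * (2 * π / q) *
          (((mollifierCoeff (X ^ 2) (qhat q ^ Δ') l * mollifierCoeff (X ^ 2) (qhat q ^ Δ') m : ℝ) : ℂ))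
      else 0)
      (fun q r l m d₁ d₂ i h₁ s ↦ D r l m d₁ d₂ i h₁ s * K (r + 1) (((l / d₁ : ℕ) : ℤ) * (m / d₂ : ℕ)) s h₁ q)
      Hf r l m d₁ d₂ i h₁ s q =
    K (r + 1) (((l / d₁ : ℕ) : ℤ) * (m / d₂ : ℕ)) s h₁ q * coreLevelWeight D Hf Δ' r l m d₁ d₂ i h₁ s q := by
  unfold coreLevelWeight levelSummand
  split_ifs <;> ring

open Classical in
/-- **`coreL R` with the level sum innermost, as `levelLargePart`s.** For levels `G` with `2 ≤ q ≤ Q` on `G`, `Δ′ ≥ 0`, any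
`Hf`, and a level-free selector `D` with `‖D‖ ≤ 1`:
`coreWithW (D·K_L) G Hf Δ′ = −re(Σ_{cell nest at Q} 𝟙[(l/d₁,r+1)=1]·Σ_{|h₁|≤H*} Σ'_s
   levelLargePart R G (coreLevelWeight D Hf Δ′ cell h₁ s) (switchMod (r+1) s h₁) (switchClass (r+1) ab s h₁))` —
`D ≡ 1` gives `coreL R G Hf Δ′` itself (`coreWith_eq_coreWithW`); `D = 𝟙_{domain}` its funded/residual cuts
(`coreWithW_eq_add_indicator`). [cite: KowalskiMichelVanderKam2000, §6 p. 19 — derivation; Davenport1980, ch. 29 — derivation] -/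
theorem coreWithW_largeKernel_eq_levels_levelLargePart (R : ℕ) (D : ℕ → ℕ → ℕ → ℕ → ℕ → ℕ × ℕ → ℤ → ℤ → ℂ)
    (hD : ∀ r l m d₁ d₂ i h₁ s, ‖D r l m d₁ d₂ i h₁ s‖ ≤ 1) (G : Finset ℕ) {Q : ℕ}
    (hG : ∀ q ∈ G, 2 ≤ q ∧ q ≤ Q) (Hf : ℕ → ℕ → ℕ → ℕ → ℕ → ℕ → ℕ × ℕ → ℕ) {Δ' : ℝ} (hΔ : 0 ≤ Δ') :
    coreWithW (fun q r l m d₁ d₂ i h₁ s ↦ D r l m d₁ d₂ i h₁ s *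
        levelLargePart R {q} (fun _ ↦ (1 : ℂ)) (switchMod (r + 1) s h₁)
          (switchClass (r + 1) (((l / d₁ : ℕ) : ℤ) * (m / d₂ : ℕ)) s h₁)) G Hf Δ' =
      -((∑ r ∈ Finset.range (Q ^ 7), ∑ l ∈ Finset.Icc 1 ⌊qhat Q ^ Δ'⌋₊, ∑ m ∈ Finset.Icc 1 ⌊qhat Q ^ Δ'⌋₊,
          ∑ d₁ ∈ l.divisors, ∑ d₂ ∈ m.divisors, ∑ i ∈ nearBoxes Q d₁ d₂ (Real.log Q ^ 4),
            if Nat.Coprime (l / d₁) (r + 1) then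
              ∑ h₁ ∈ Icc (-((G.sup (fun q ↦ Hf q d₁ d₂ (l / d₁) (m / d₂) (r + 1) i) : ℕ) : ℤ))
                  ((G.sup (fun q ↦ Hf q d₁ d₂ (l / d₁) (m / d₂) (r + 1) i) : ℕ) : ℤ),
                ∑' s : ℤ,
                  levelLargePart R G (coreLevelWeight D Hf Δ' r l m d₁ d₂ i h₁ s) (switchMod (r + 1) s h₁)
                    (switchClass (r + 1) (((l / d₁ : ℕ) : ℤ) * (m / d₂ : ℕ)) s h₁)
            else 0).re) := by
  classical
  -- the weight is bounded by `1·1` (at `h₁ = 0` the reduced modulus is `0`, `φ(0) = 0`, and the kernel vanishes)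
  have hW : ∀ q r l m d₁ d₂ i h₁ s, ‖D r l m d₁ d₂ i h₁ s *
      levelLargePart R {q} (fun _ ↦ (1 : ℂ)) (switchMod (r + 1) s h₁)
        (switchClass (r + 1) (((l / d₁ : ℕ) : ℤ) * (m / d₂ : ℕ)) s h₁)‖ ≤ 1 := by
    intro q r l m d₁ d₂ i h₁ s
    rw [norm_mul]
    by_cases hh : h₁ = 0
    · have hmod : switchMod (r + 1) s h₁ = 0 := by
        rw [switchMod, hh, Int.zero_ediv, Int.natAbs_zero]
      have hφ : ((Nat.totient (switchMod (r + 1) s h₁) : ℂ))⁻¹ = 0 := by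
        rw [hmod, Nat.totient_zero, Nat.cast_zero, inv_zero]
      have hL : levelLargePart R {q} (fun _ ↦ (1 : ℂ)) (switchMod (r + 1) s h₁)
          (switchClass (r + 1) (((l / d₁ : ℕ) : ℤ) * (m / d₂ : ℕ)) s h₁) = 0 := by
        unfold levelLargePart
        rw [hφ, zero_mul]
      rw [hL, norm_zero, mul_zero]
      exact zero_le_one
    · haveI : NeZero (switchMod (r + 1) s h₁) := ⟨switchMod_ne_zero _ s hh⟩
      calc _ ≤ 1 * 1 := mul_le_mul (hD r l m d₁ d₂ i h₁ s)
            (norm_kernels_le R (switchClass (r + 1) (((l / d₁ : ℕ) : ℤ) * (m / d₂ : ℕ)) s h₁)).2.2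
            (norm_nonneg _) zero_le_one
        _ = 1 := one_mul _
  rw [coreWithW_eq_levels hW G hG Hf hΔ]
  refine neg_re_congr ?_
  refine Finset.sum_congr rfl fun r _ ↦ Finset.sum_congr rfl fun l _ ↦ Finset.sum_congr rfl fun m _ ↦
    Finset.sum_congr rfl fun d₁ _ ↦ Finset.sum_congr rfl fun d₂ _ ↦ Finset.sum_congr rfl fun i _ ↦ ?_
  split_ifs with hcop
  · refine Finset.sum_congr rfl fun h₁ _ ↦ tsum_congr fun s ↦ ?_
    rw [← sum_levelLargePart_singleton_mul G (coreLevelWeight D Hf Δ' r l m d₁ d₂ i h₁ s)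
      (switchMod (r + 1) s h₁) R (switchClass (r + 1) (((l / d₁ : ℕ) : ℤ) * (m / d₂ : ℕ)) s h₁)]
    refine Finset.sum_congr rfl fun q _ ↦ ?_
    unfold coreLevelWeight levelSummand
    split_ifs <;> ring
  · rfl

end Summit.Parity.GeneralizedHardyLittlewood.Theorems.BeyondDiagonalBeatsQuarter.OffDiag
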